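import Summits.NavierStokesRegularity.FunctionalMining.StrainEigen
import HarnessLib

/-!
# FunctionalMining — the EIKONAL OBSTRUCTION of `SIEVELD.md` §3.4b (4b)(ii) in the kernel:
# no smooth field on the torus has a globally biaxial strain `m(1 − 3 n⊗n)`, `m ≠ 0` constant,
# whose axis `n` is independent of one coordinate

Search for candidate a priori estimates; no regularity claim. Cell `pub-nsfunc`, prove seat
(gen 20). Static calculus of smooth fields on the flat torus; nothing about Navier–Stokes dynamics.

CONTEXT (the open node L-λ of the `T_LD` classification, `TopEigHeatCoercive.lean`). A violating
structure for Lemma L-λ must make the heat dissipation `D₀` of `∫(λ₁⁺)^q` small; the density of `D₀`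
vanishes exactly at DIRECTOR points and at BIAXIAL points `S = m(1 − 3 n⊗n)` (`|n| = 1`; eigenvalues
`m, m, −2m`) (`SIEVELD.md` §3.4b (3)). The no-go seat's rigidity lemma §3.4b (4b)(ii) ("EIKONAL
OBSTRUCTION", pen-and-paper, nogo g9) says: *there is no smooth periodic divergence-free `u` whose strain
is globally biaxial `m(1 − 3n⊗n)`, `m ≠ 0` constant, with axis `n` independent of one coordinate.*
This file proves it — and the stronger statement that a field which (or whose strain) is independent
of one coordinate has a DEGENERATE strain somewhere — for every finite index type `d` and every
coordinate `k : d` (the case of interest is `d = Fin 3`):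

* `partialDeriv_eq_zero_of_strain_invariant` (**strain translation rigidity**): if the strain matrix
  `S(v) = sym ∇v` of a smooth field `v` on `T^d` is invariant under the translations `x ↦ x + t eₖ`, then
  `∂ₖ v ≡ 0` — because `w := ∂ₖv` is then a Killing field of the flat torus (`sym ∇w = ∂ₖ sym ∇v = 0`),
  every Killing field of the flat torus is parallel (`killing_parallel`: `∂ₖ∂ⱼwᵢ` is symmetric in
  `(k, j)` and antisymmetric in `(i, j)`, hence `0`, so each `∂ⱼwᵢ` is a constant with zero integral),
  and a parallel field that is a derivative has zero integral, hence vanishes. (SIEVELD argues instead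
  through `Δu = 2 div S`; the conclusion `∂ₖu ≡ 0` is the same.)
* `exists_strain_col_eq_zero` (**the general principle**): if `∂ₖ v ≡ 0`, then at any extremum `p` of the
  periodic function `v_k` (Fermat, `partialDeriv_eq_zero_of_forall_le`) the `k`-th column of the strain
  vanishes, `S(v)(p)ᵢₖ = ½(∂ₖvᵢ + ∂ᵢv_k)(p) = 0`: **a field independent of one coordinate — or, by
  rigidity, a field whose STRAIN is independent of one coordinate — has a somewhere-degenerate strain**
  (`exists_det_strain_eq_zero_of_strain_invariant`).
* `no_biaxial_strain_of_partialDeriv_eq_zero`: a biaxial matrix `m(1 − 3n⊗n)`, `m ≠ 0`, `|n| = 1`, has no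
  vanishing column (`biaxial_col_ne_zero`: the `(k,k)` entry gives `3n_k² = 1`, the others `nᵢn_k = 0`, so
  `|n|² = 1/3`); hence NO field with `∂ₖv ≡ 0` is biaxial at every point — even with axis AND modulus
  `m(x) ≠ 0` varying from point to point (a strengthening of (4b)(ii), which has `m` constant).
* `no_biaxial_strain_of_axis_invariant` (**(4b)(ii) as stated**): `S(v) = m(1 − 3 n⊗n)` with `m ≠ 0`
  constant, `∑ᵢ nᵢ² = 1` and `n(x + t eₖ) = n(x)` is impossible (the strain is `eₖ`-invariant, so
  rigidity gives `∂ₖv ≡ 0`); `no_biaxial_strain_of_axis_invariant_of_isDivFree`: at `card d = 3` the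
  normalisation `|n| = 1` is equivalent to `div v = 0` (trace), which is how SIEVELD phrases it.
Tools (generic torus calculus, [folklore]): `partialDeriv_eq_zero_of_forall_add_proj` (a function
invariant under `x ↦ x + t eₖ` has `∂ₖ = 0`), `eq_of_forall_partialDeriv_eq_zero` (vanishing partials ⇒
constant, via Mathlib `is_const_of_fderiv_eq_zero` on the lift), `eq_zero_of_forall_partialDeriv_eq_zero`
(… and zero integral ⇒ zero), `partialDeriv_eq_zero_of_forall_le` / `exists_forall_partialDeriv_eq_zero`
(Fermat at a maximum point of a continuous periodic function; Mathlib `IsLocalMax.deriv_eq_zero`,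
`IsCompact.exists_isMaxOn`).
NOT here: the fully three-dimensional case (axis turning in all directions — §3.4b (4d), pen-and-paper),
anything about minimising sequences of L-λ, any verdict change. [ours = the assembly; folklore = tools]
-/

noncomputable section

open MeasureTheory Set Filter Topology

namespace Summit.NavierStokesRegularity.FunctionalMining
open Literature.Analysis Literature.Analysis.FunctionSpaces Literature.Analysis.FunctionSpaces.Torus
  Literature.Analysis.FluidPDE

namespace BiaxialEikonal

variable {d : Type*} [Fintype d] [DecidableEq d]
variable {F : Type*} [NormedAddCommGroup F] [NormedSpace ℝ F]

/-! ## 1. Torus calculus tools -/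

omit [Fintype d] in
/-- A function invariant under the translations `x ↦ x + t·eₖ` has vanishing `k`-th partial derivative
(the one-variable function differentiated in `Torus.partialDeriv` is constant). [folklore] -/
theorem partialDeriv_eq_zero_of_forall_add_proj {f : UnitAddTorus d → F} {k : d} {x : UnitAddTorus d}
    (h : ∀ t : ℝ, f (x + proj (t • EuclideanSpace.single k (1 : ℝ))) = f x) :
    Torus.partialDeriv k f x = 0 := by
  show deriv (fun t : ℝ => f (x + proj (t • EuclideanSpace.single k (1 : ℝ)))) 0 = 0
  rw [show (fun t : ℝ => f (x + proj (t • EuclideanSpace.single k (1 : ℝ)))) = fun _ => f x from funext h]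
  exact deriv_const 0 (f x)

/-- A `C¹` function on the torus all of whose partial derivatives vanish is constant (Mathlib
`is_const_of_fderiv_eq_zero` applied to the lift to `ℝ^d`). [folklore] -/
theorem eq_of_forall_partialDeriv_eq_zero {f : UnitAddTorus d → F} (hf : Torus.IsContDiff 1 f)
    (h : ∀ j x, Torus.partialDeriv j f x = 0) (x y : UnitAddTorus d) : f x = f y := by
  have hdiff : Differentiable ℝ (lift f) := ContDiff.differentiable hf (by simp)
  have hzero : ∀ z, _root_.fderiv ℝ (lift f) z = 0 := by
    intro z
    rw [fderiv_lift]
    ext w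
    simp [fderiv_apply_eq_sum_partialDeriv hf, h]
  have := is_const_of_fderiv_eq_zero hdiff hzero (repr x) (repr y)
  rwa [lift_repr, lift_repr] at this

/-- A `C¹` real function on the torus with vanishing partial derivatives and zero integral vanishes
identically (it is the constant `∫ f`). [folklore] -/
theorem eq_zero_of_forall_partialDeriv_eq_zero {f : UnitAddTorus d → ℝ} (hf : Torus.IsContDiff 1 f)
    (h : ∀ j x, Torus.partialDeriv j f x = 0) (h0 : ∫ x, f x = 0) (x : UnitAddTorus d) : f x = 0 := by
  have hconst : ∀ y, f y = f x := fun y => eq_of_forall_partialDeriv_eq_zero hf h y x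
  have hint : ∫ y, f y = f x := by
    rw [show (fun y => f y) = fun _ => f x from funext hconst, integral_const, smul_eq_mul,
      probReal_univ, one_mul]
  rw [← hint, h0]

omit [Fintype d] in
/-- FERMAT ON THE TORUS: at a maximum point of ANY function `f : T^d → ℝ` every partial derivative
vanishes (`Torus.partialDeriv` is a one-variable `deriv`, and Mathlib's `IsLocalMax.deriv_eq_zero` needs no
differentiability). [folklore] -/
theorem partialDeriv_eq_zero_of_forall_le {f : UnitAddTorus d → ℝ} {p : UnitAddTorus d}
    (hp : ∀ x, f x ≤ f p) (j : d) : Torus.partialDeriv j f p = 0 := by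
  show deriv (fun t : ℝ => f (p + proj (t • EuclideanSpace.single j (1 : ℝ)))) 0 = 0
  apply IsLocalMax.deriv_eq_zero
  refine Filter.Eventually.of_forall fun t => ?_
  dsimp only
  rw [zero_smul, proj_zero, add_zero]
  exact hp _

omit [Fintype d] in
/-- A continuous function on the (compact) torus has a critical point: a point where every partial
derivative vanishes (any maximum point). [folklore] -/
theorem exists_forall_partialDeriv_eq_zero {f : UnitAddTorus d → ℝ} (hf : Continuous f) :
    ∃ p, (∀ x, f x ≤ f p) ∧ ∀ j, Torus.partialDeriv j f p = 0 := by
  obtain ⟨p, -, hp⟩ := isCompact_univ.exists_isMaxOn univ_nonempty hf.continuousOn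
  have hp' : ∀ x, f x ≤ f p := fun x => hp (mem_univ x)
  exact ⟨p, hp', partialDeriv_eq_zero_of_forall_le hp'⟩

/-! ## 2. Killing fields of the flat torus are parallel, and derivatives among them vanish -/

/-- **Killing fields of the flat torus are parallel.** If `w` is smooth on `T^d` and its strain
vanishes, `∂ⱼwᵢ + ∂ᵢwⱼ ≡ 0`, then `∂ⱼ w ≡ 0` for every `j`. Proof: `b_{kij} := ∂ₖ∂ⱼwᵢ` is symmetric in
`(k, j)` and antisymmetric in `(i, j)`, hence zero (`b_{kij} = b_{jik} = −b_{jki} = −b_{ikj} = b_{ijk} =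
b_{kji} = −b_{kij}`); so each `∂ⱼwᵢ` is constant, and its integral over the torus is `0`. [folklore] -/
theorem killing_parallel {w : UnitAddTorus d → EuclideanSpace ℝ d} (hw : Torus.IsSmooth w)
    (hK : ∀ x i j, Torus.partialDeriv j w x i + Torus.partialDeriv i w x j = 0) (j : d)
    (x : UnitAddTorus d) : Torus.partialDeriv j w x = 0 := by
  -- `a i j := ∂ⱼ wᵢ` as a real function on the torus
  set a : d → d → UnitAddTorus d → ℝ := fun i j y => Torus.partialDeriv j w y i with ha
  have ha1 : ∀ i j, Torus.IsSmooth (a i j) := fun i j => (hw.partialDeriv j).apply i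
  have hanti : ∀ i j, a i j = fun y => -a j i y := fun i j => funext fun y => by
    have := hK y i j; simp only [ha]; linarith
  -- `b k i j y := ∂ₖ (a i j) y = (∂ₖ∂ⱼ w y)ᵢ`
  have hb : ∀ k i j y, Torus.partialDeriv k (a i j) y = Torus.partialDeriv k (Torus.partialDeriv j w) y i :=
    fun k i j y => partialDeriv_apply_coord ((hw.partialDeriv j).isContDiff (by simp)) k y i
  have hsym : ∀ k i j y, Torus.partialDeriv k (a i j) y = Torus.partialDeriv j (a i k) y := by
    intro k i j y
    rw [hb, hb, partialDeriv_comm hw k j y]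
  have hant : ∀ k i j y, Torus.partialDeriv k (a i j) y = -Torus.partialDeriv k (a j i) y := by
    intro k i j y
    rw [hanti i j, partialDeriv_neg]
  have hb0 : ∀ k i j y, Torus.partialDeriv k (a i j) y = 0 := by
    intro k i j y
    have h1 := hsym k i j y
    have h2 := hant j i k y
    have h3 := hsym j k i y
    have h4 := hant i k j y
    have h5 := hsym i j k y
    have h6 := hant k j i y
    linarith
  -- each `a i j` is a constant with zero integral
  have hint : ∀ i j, ∫ y, a i j y = 0 := by
    intro i j
    have : (fun y => a i j y) = fun y => Torus.partialDeriv j (fun z => w z i) y :=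
      funext fun y => (partialDeriv_apply_coord (hw.isContDiff (by simp)) j y i).symm
    rw [this]
    exact integral_partialDeriv_eq_zero_holds (hw.apply i) j
  have hzero : ∀ i, a i j x = 0 := fun i =>
    eq_zero_of_forall_partialDeriv_eq_zero ((ha1 i j).isContDiff (by simp)) (fun k y => hb0 k i j y)
      (hint i j) x
  ext i
  exact hzero i

/-- The partial derivative `∂ₖ` of twice a strain entry is twice the strain entry of `∂ₖv`:
`∂ₖ(∂ⱼvᵢ + ∂ᵢvⱼ) = ∂ⱼ(∂ₖv)ᵢ + ∂ᵢ(∂ₖv)ⱼ` (mixed partials of a smooth field commute). [folklore] -/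
theorem partialDeriv_twoStrain {v : UnitAddTorus d → EuclideanSpace ℝ d} (hv : Torus.IsSmooth v)
    (k i j : d) (x : UnitAddTorus d) :
    Torus.partialDeriv k (fun y => Torus.partialDeriv j v y i + Torus.partialDeriv i v y j) x =
      Torus.partialDeriv j (Torus.partialDeriv k v) x i + Torus.partialDeriv i (Torus.partialDeriv k v) x j := by
  have h1 : ∀ l m : d, Torus.IsContDiff 1 (fun y => Torus.partialDeriv l v y m) :=
    fun l m => ((hv.partialDeriv l).apply m).isContDiff (by simp)
  rw [show (fun y => Torus.partialDeriv j v y i + Torus.partialDeriv i v y j) =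
      (fun y => Torus.partialDeriv j v y i) + fun y => Torus.partialDeriv i v y j from rfl,
    partialDeriv_add (h1 j i) (h1 i j), Pi.add_apply,
    partialDeriv_apply_coord ((hv.partialDeriv j).isContDiff (by simp)) k x i,
    partialDeriv_apply_coord ((hv.partialDeriv i).isContDiff (by simp)) k x j,
    partialDeriv_comm hv k j x, partialDeriv_comm hv k i x]

/-- The strain matrix entry, unfolded. [folklore] -/
theorem torusStrainMatrix_apply (v : UnitAddTorus d → EuclideanSpace ℝ d) (x : UnitAddTorus d)
    (i j : d) :
    torusStrainMatrix v x i j = (Torus.partialDeriv j v x i + Torus.partialDeriv i v x j) / 2 := rfl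

/-- **STRAIN TRANSLATION RIGIDITY.** If the strain matrix of a smooth field `v` on the torus is
invariant under the translations `x ↦ x + t·eₖ`, then `∂ₖ v ≡ 0` (the field itself is invariant):
`w := ∂ₖ v` is a Killing field (`sym ∇w = ∂ₖ sym ∇v = 0`), hence parallel (`killing_parallel`), hence a
constant — whose integral `∫ ∂ₖ vᵢ = 0` vanishes. [ours] -/
theorem partialDeriv_eq_zero_of_strain_invariant {v : UnitAddTorus d → EuclideanSpace ℝ d}
    (hv : Torus.IsSmooth v) (k : d)
    (hS : ∀ (x : UnitAddTorus d) (t : ℝ), torusStrainMatrix v (x + proj (t • EuclideanSpace.single k (1 : ℝ)))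
      = torusStrainMatrix v x) (x : UnitAddTorus d) :
    Torus.partialDeriv k v x = 0 := by
  set w := Torus.partialDeriv k v with hw
  have hws : Torus.IsSmooth w := hv.partialDeriv k
  -- `w` is a Killing field
  have hK : ∀ y i j, Torus.partialDeriv j w y i + Torus.partialDeriv i w y j = 0 := by
    intro y i j
    rw [hw, ← partialDeriv_twoStrain hv k i j y]
    apply partialDeriv_eq_zero_of_forall_add_proj
    intro t
    have h := congrFun (congrFun (hS y t) i) j
    rw [torusStrainMatrix_apply, torusStrainMatrix_apply] at h
    linarith
  -- hence parallel, hence constant; the constant has zero integral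
  have hpar : ∀ j y, Torus.partialDeriv j w y = 0 := fun j y => killing_parallel hws hK j y
  have hcomp : ∀ i, w x i = 0 := by
    intro i
    have h1 : Torus.IsContDiff 1 (fun y => w y i) := (hws.apply i).isContDiff (by simp)
    refine eq_zero_of_forall_partialDeriv_eq_zero h1 (fun j y => ?_) ?_ x
    · rw [partialDeriv_apply_coord (hws.isContDiff (by simp)) j y i, hpar j y]
      rfl
    · have : (fun y => w y i) = fun y => Torus.partialDeriv k (fun z => v z i) y :=
        funext fun y => (partialDeriv_apply_coord (hv.isContDiff (by simp)) k y i).symm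
      rw [this]
      exact integral_partialDeriv_eq_zero_holds (hv.apply i) k
  ext i
  exact hcomp i

/-! ## 3. A field independent of one coordinate has a somewhere-degenerate strain -/

/-- If `∂ₖ v ≡ 0`, then at every critical point `p` of the component `v_k` the `k`-th column (and row)
of the strain vanishes: `S(p)ᵢₖ = ½(∂ₖvᵢ + ∂ᵢv_k)(p) = 0`. [ours; elementary] -/
theorem strain_col_eq_zero_of_critical {v : UnitAddTorus d → EuclideanSpace ℝ d} (hv : Torus.IsContDiff 1 v)
    {k : d} (hk : ∀ x, Torus.partialDeriv k v x = 0) {p : UnitAddTorus d}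
    (hp : ∀ i, Torus.partialDeriv i (fun y => v y k) p = 0) (i : d) :
    torusStrainMatrix v p i k = 0 ∧ torusStrainMatrix v p k i = 0 := by
  have h1 : Torus.partialDeriv i v p k = 0 := by rw [← partialDeriv_apply_coord hv i p k, hp i]
  have h2 : Torus.partialDeriv k v p i = 0 := by rw [hk p]; rfl
  rw [torusStrainMatrix_apply, torusStrainMatrix_apply, h1, h2, add_zero, zero_div]
  exact ⟨rfl, rfl⟩

/-- **A SMOOTH FIELD ON THE TORUS THAT IS INDEPENDENT OF ONE COORDINATE HAS A DEGENERATE STRAIN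
SOMEWHERE**: if `∂ₖ v ≡ 0` there is a point `p` (any extremum of the periodic function `v_k`) where the
`k`-th column of `S(v)` vanishes, `S(v)(p) eₖ = 0`. [ours; elementary] -/
theorem exists_strain_col_eq_zero {v : UnitAddTorus d → EuclideanSpace ℝ d} (hv : Torus.IsSmooth v)
    {k : d} (hk : ∀ x, Torus.partialDeriv k v x = 0) :
    ∃ p, ∀ i, torusStrainMatrix v p i k = 0 := by
  obtain ⟨p, -, hp⟩ := exists_forall_partialDeriv_eq_zero (hv.apply k).continuous
  exact ⟨p, fun i => (strain_col_eq_zero_of_critical (hv.isContDiff (by simp)) hk hp i).1⟩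

/-- The same under the weaker hypothesis that only the STRAIN is independent of the coordinate `xₖ`
(strain translation rigidity upgrades it to `∂ₖ v ≡ 0`). [ours] -/
theorem exists_strain_col_eq_zero_of_strain_invariant {v : UnitAddTorus d → EuclideanSpace ℝ d}
    (hv : Torus.IsSmooth v) (k : d)
    (hS : ∀ (x : UnitAddTorus d) (t : ℝ), torusStrainMatrix v (x + proj (t • EuclideanSpace.single k (1 : ℝ)))
      = torusStrainMatrix v x) :
    ∃ p, ∀ i, torusStrainMatrix v p i k = 0 :=
  exists_strain_col_eq_zero hv (partialDeriv_eq_zero_of_strain_invariant hv k hS)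

/-- In particular a strain field on the torus that is independent of one coordinate is singular
somewhere: `∃ p, det S(v)(p) = 0`. [ours] -/
theorem exists_det_strain_eq_zero_of_strain_invariant {v : UnitAddTorus d → EuclideanSpace ℝ d}
    (hv : Torus.IsSmooth v) (k : d)
    (hS : ∀ (x : UnitAddTorus d) (t : ℝ), torusStrainMatrix v (x + proj (t • EuclideanSpace.single k (1 : ℝ)))
      = torusStrainMatrix v x) :
    ∃ p, (torusStrainMatrix v p).det = 0 := by
  obtain ⟨p, hp⟩ := exists_strain_col_eq_zero_of_strain_invariant hv k hS
  exact ⟨p, Matrix.det_eq_zero_of_column_eq_zero k hp⟩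

/-! ## 4. The eikonal obstruction (SIEVELD §3.4b (4b)(ii)): biaxial strains are nowhere degenerate -/

/-- Pointwise algebra: a biaxial matrix `m·(1 − 3 n⊗n)` with `m ≠ 0`, `∑ᵢnᵢ² = 1` has no vanishing
column (the `(k,k)` entry gives `3n_k² = 1`, the others `nᵢ n_k = 0`, so `|n|² = n_k² = 1/3`). [ours] -/
theorem biaxial_col_ne_zero {m : ℝ} (hm : m ≠ 0) {n : d → ℝ} (hn1 : ∑ i, n i ^ 2 = 1) (k : d)
    (h : ∀ i, (m • (1 - (3 : ℝ) • Matrix.vecMulVec n n) : Matrix d d ℝ) i k = 0) : False := by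
  have he : ∀ i, m * ((if i = k then 1 else 0) - 3 * (n i * n k)) = 0 := by
    intro i
    have hi := h i
    rw [Matrix.smul_apply, Matrix.sub_apply, Matrix.one_apply, Matrix.smul_apply, Matrix.vecMulVec_apply,
      smul_eq_mul, smul_eq_mul] at hi
    exact hi
  have hnk2 : 3 * (n k * n k) = 1 := by
    have := (mul_eq_zero.mp (he k)).resolve_left hm
    rw [if_pos rfl] at this
    linarith
  have hnp : ∀ i, i ≠ k → n i = 0 := by
    intro i hi
    have h0 := (mul_eq_zero.mp (he i)).resolve_left hm
    rw [if_neg hi, zero_sub, neg_eq_zero] at h0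
    rcases mul_eq_zero.mp h0 with h3 | h6
    · norm_num at h3
    rcases mul_eq_zero.mp h6 with h7 | h7
    · exact h7
    · exfalso; rw [h7, mul_zero, mul_zero] at hnk2; exact zero_ne_one hnk2
  have hsum : ∑ i, n i ^ 2 = n k ^ 2 :=
    Finset.sum_eq_single k (fun i _ hi => by rw [hnp i hi]; ring) (fun h => absurd (Finset.mem_univ k) h)
  rw [hsum] at hn1
  nlinarith

/-- **NO 2.5-D BIAXIAL STRAIN, even of variable modulus.** A smooth field `v` on `T^d` with `∂ₖv ≡ 0`
cannot have, at every point, a biaxial strain `S(v)(x) = m(x)·(1 − 3 n_x⊗n_x)` with `m(x) ≠ 0` and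
`|n_x| = 1` (axis and modulus may vary from point to point): at an extremum of `v_k` the `k`-th column of
the strain vanishes (`exists_strain_col_eq_zero`), which a biaxial matrix does not allow
(`biaxial_col_ne_zero`). For `d = Fin 3`: no `x₃`-independent smooth field is top-biaxial
(`λ₁ = λ₂ > 0 > λ₃`) or bottom-biaxial everywhere. [ours] -/
theorem no_biaxial_strain_of_partialDeriv_eq_zero {v : UnitAddTorus d → EuclideanSpace ℝ d}
    (hv : Torus.IsSmooth v) {k : d} (hk : ∀ x, Torus.partialDeriv k v x = 0) {m : UnitAddTorus d → ℝ}
    (hm : ∀ x, m x ≠ 0)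
    (hS : ∀ x, ∃ n : d → ℝ, ∑ i, n i ^ 2 = 1 ∧
      torusStrainMatrix v x = m x • (1 - (3 : ℝ) • Matrix.vecMulVec n n)) : False := by
  obtain ⟨p, hp⟩ := exists_strain_col_eq_zero hv hk
  obtain ⟨n, hn1, hSp⟩ := hS p
  exact biaxial_col_ne_zero (hm p) hn1 k fun i => by rw [← hSp]; exact hp i

/-- **THE EIKONAL OBSTRUCTION, SIEVELD §3.4b (4b)(ii).** There is no smooth field `v` on `T^d` whose
strain matrix is `S(v)(x) = m·(1 − 3 n(x)⊗n(x))` with `m ≠ 0` CONSTANT, `|n(x)| = 1`, and axis `n`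
invariant under the translations `x ↦ x + t·eₖ` of one coordinate direction `k` (for `d = Fin 3`: a
globally biaxial strain of constant modulus, eigenvalues `m, m, −2m`, whose axis is independent of one
coordinate; `|n| = 1` makes `v` divergence free). Proof: the strain is then `eₖ`-translation invariant,
so `∂ₖv ≡ 0` by strain translation rigidity, and `no_biaxial_strain_of_partialDeriv_eq_zero` applies.
(SIEVELD's pen proof: `u` is `z`-independent, `S₃₃ = 0` forces `n₃² ≡ 1/3`, `(S₁₃, S₂₃) = ½∇ₕu₃` gives
`|∇ₕ u₃|² ≡ 8m²`, impossible at a critical point of the periodic `u₃` — the same point `p`.) [ours] -/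
theorem no_biaxial_strain_of_axis_invariant {v : UnitAddTorus d → EuclideanSpace ℝ d}
    (hv : Torus.IsSmooth v) {m : ℝ} (hm : m ≠ 0) (k : d) {n : UnitAddTorus d → d → ℝ}
    (hn1 : ∀ x, ∑ i, n x i ^ 2 = 1)
    (hnk : ∀ (x : UnitAddTorus d) (t : ℝ), n (x + proj (t • EuclideanSpace.single k (1 : ℝ))) = n x)
    (hS : ∀ x, torusStrainMatrix v x = m • (1 - (3 : ℝ) • Matrix.vecMulVec (n x) (n x))) : False := by
  have hk : ∀ x, Torus.partialDeriv k v x = 0 := by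
    refine partialDeriv_eq_zero_of_strain_invariant hv k fun x t => ?_
    rw [hS, hS, hnk]
  exact no_biaxial_strain_of_partialDeriv_eq_zero hv hk (fun _ => hm) fun x => ⟨n x, hn1 x, hS x⟩

/-- At `card d = 3`, for a divergence-free field the normalisation `|n| = 1` of the axis is automatic
(`tr S = div v = 0` and `tr (m(1 − 3n⊗n)) = m(3 − 3|n|²)`), so (4b)(ii) reads exactly as in
`SIEVELD.md`: **no smooth divergence-free field on `T³` has strain `m(1 − 3 n⊗n)`, `m ≠ 0` constant, with
`n` independent of one coordinate.** [ours] -/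
theorem no_biaxial_strain_of_axis_invariant_of_isDivFree (hd : Fintype.card d = 3)
    {v : UnitAddTorus d → EuclideanSpace ℝ d} (hv : Torus.IsSmooth v) (hdiv : Torus.IsDivFree v)
    {m : ℝ} (hm : m ≠ 0) (k : d) {n : UnitAddTorus d → d → ℝ}
    (hnk : ∀ (x : UnitAddTorus d) (t : ℝ), n (x + proj (t • EuclideanSpace.single k (1 : ℝ))) = n x)
    (hS : ∀ x, torusStrainMatrix v x = m • (1 - (3 : ℝ) • Matrix.vecMulVec (n x) (n x))) : False := by
  refine no_biaxial_strain_of_axis_invariant hv hm k (fun x => ?_) hnk hS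
  -- trace: `0 = tr S(x) = m (3 − 3 ∑ nᵢ²)`
  have htr := torusStrainMatrix_trace_eq_zero hv hdiv x
  rw [hS x, Matrix.trace_smul, Matrix.trace_sub, Matrix.trace_one, Matrix.trace_smul, Matrix.trace_vecMulVec,
    hd, smul_eq_mul, smul_eq_mul] at htr
  have h3 : (3 : ℝ) - 3 * (n x ⬝ᵥ n x) = 0 := by
    have := mul_eq_zero.mp htr
    push_cast at this
    exact this.resolve_left hm
  have hdot : n x ⬝ᵥ n x = ∑ i, n x i ^ 2 := by simp [dotProduct, sq]
  linarith [hdot]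

end BiaxialEikonal

end Summit.NavierStokesRegularity.FunctionalMining

end
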